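import Summits.CriticalPhenomena.PercolationContinuityZ3.Theorems.PercNearOneGluingNoHeavyQuantFarTreeLevelBounds
import Summits.CriticalPhenomena.PercolationContinuityZ3.Theorems.PercNearOneGluingNoHeavyQuantIndepBlobMoments
import HarnessLib

/-!
# QUANT lane R8, independent blobs at LOW FLOOR (`x ≤ 1/3`): the far-relay row with SUB-FLOOR blobs counted at FULL credit

builds on p205010 (kernel theorem, internal audit signed; external expert review pending)

Support file (`--supports stmt-CriticalPhenomena-4575`), QUANT lane census seat prim-quant-census-1 (gen 14), rung R8 of
`run/shared/lean/prim/quant/LADDER.md`; memo `run/shared/lean/prim/quant/prim-quant-census-1/TREES-G14.md` §3.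

Context.  census-2 g49 (`prim-quant-census-2-g49/ARCH-TREES-G49.md`) reduces `Quant.FarTreeRow` on every tree to ONE row about independent
two-point blobs, conjecture DIB\*: blobs `(a_k, g_k)` independent, floor `x`, LIGHT blobs (`g_k < x`) of size `≤ j` credited at the discounted
rate `a_k (g_k − x²)/(1 − x)`, heavy ones at `a_k g_k`; credit `> 2j ⟹ P(N ≥ j+1) ≥ x`.  This file proves the LOW-FLOOR THIRD of DIB\* in a
stronger form — no discount at all:

* `IndepBlob.count_cantelli` — Cantelli for the weighted count: `P(X ≤ j) ≤ V/(V + (m − j)²)`, `m = ∑ a p`, `V = ∑ a² p (1 − p)`, `j < m`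
  (instance of `Quant.bernoulliWeight_cantelli`).
* `IndepBlob.lowFloor_row` — **gates ARBITRARY in `[0,1]`, weights `a i ≥ 0`, `0 ≤ j`, `2j < m = ∑ a p` (the TRUE mean), and every blob
  heavier than `m/2` has gate `≥ x`; then `P(X ≤ j) ≤ 1 − x` for every `x ≤ 1/3`.**  Proof: a blob with `a i > m/2 > j` decides alone
  (`P(X ≤ j) ≤ P(i closed) = 1 − p i ≤ 1 − x`); otherwise `V ≤ (m/2)·m` and Cantelli gives `P(X ≤ j) ≤ P(X < m/2)… ≤ 2/3 ≤ 1 − x`.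
  So for floors `x ≤ 1/3` sub-floor ("light") blobs of size `≤ j` count at full credit `a g`; the discount of DIB\* is only needed above `1/3`
  (census: the discount is sharp near `x → 1`, ARCH-TREES-G49 §3.2–3.3).  With `x = min gate` this is the Cantelli half of
  `IndepBlob.halfMean_smallBall` (`…QuantIndepBlobMoments.lean`, which reaches `p₀ ≤ 1/2` by conditioning on the least gate).
[cite: KozmaNitzan2024, Conjecture 3 (p. 15)] (the gluing rows served); [folklore; Cantelli 1928] (one-sided Chebyshev); the row is [this work].
Theorems only, no sorries, standard axioms.
-/

namespace Summit.CriticalPhenomena.PercolationContinuityZ3.Theorems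

namespace Quant

namespace IndepBlob

open Finset
open scoped Classical

variable {ι : Type*} [Fintype ι] [DecidableEq ι]

/-- **Cantelli for the weighted count of independent blobs.**  Gates `0 ≤ p i ≤ 1`, weights `a i`, `m = ∑ a p`,
`V = ∑ a² p (1 − p)`, `j < m`: `P(∑_{i∈W} a i ≤ j) ≤ V / (V + (m − j)²)`. [folklore; Cantelli 1928] -/
theorem count_cantelli (p a : ι → ℝ) (hp0 : ∀ i, 0 ≤ p i) (hp1 : ∀ i, p i ≤ 1) (j : ℝ)
    (hj : j < ∑ i, a i * p i) :
    ∑ W ∈ (Finset.univ : Finset (Finset ι)).filter (fun W => ∑ i ∈ W, a i ≤ j), (∏ k, if k ∈ W then p k else 1 - p k) ≤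
      (∑ i, a i ^ 2 * p i * (1 - p i)) / ((∑ i, a i ^ 2 * p i * (1 - p i)) + ((∑ i, a i * p i) - j) ^ 2) := by
  set m : ℝ := ∑ i, a i * p i with hm
  set V : ℝ := ∑ i, a i ^ 2 * p i * (1 - p i) with hV
  have hmean : ∑ W : Finset ι, (∏ k, if k ∈ W then p k else 1 - p k) * (∑ i ∈ W, a i) = m :=
    sum_bernoulliWeight_mul_count p a
  have hvar : ∑ W : Finset ι, (∏ k, if k ∈ W then p k else 1 - p k) * ((∑ i ∈ W, a i) - m) ^ 2 = V := by
    have h := sum_bernoulliWeight_mul_sq_sub p a m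
    rw [← hm, sub_self, zero_pow two_ne_zero, zero_add] at h
    rw [hV, ← h]
    exact Finset.sum_congr rfl fun W _ => by ring
  exact bernoulliWeight_cantelli p hp0 hp1 (fun W => ∑ i ∈ W, a i) m V j hmean hvar hj

/-- **LOW-FLOOR ROW (sub-floor blobs at full credit).**  Independent blobs with ARBITRARY gates `0 ≤ p i ≤ 1` and weights `a i ≥ 0`;
`0 ≤ j`, `2j < m := ∑ a p`; every blob of weight `> m/2` has gate `≥ x`.  Then `P(∑_{i∈W} a i ≤ j) ≤ 1 − x` for every `x ≤ 1/3`: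
the far-relay row at floor `x` in which blobs BELOW the floor (gate `< x`, weight `≤ m/2`) still count with their full mean.
(A blob heavier than `m/2 > j` decides alone; otherwise Cantelli with `V ≤ m²/2` gives `P ≤ 2/3`.) [this work] -/
theorem lowFloor_row (p a : ι → ℝ) (hp0 : ∀ i, 0 ≤ p i) (hp1 : ∀ i, p i ≤ 1) (ha : ∀ i, 0 ≤ a i)
    (x j : ℝ) (hx : x ≤ 1 / 3) (hj0 : 0 ≤ j) (hj : 2 * j < ∑ i, a i * p i)
    (hgiant : ∀ i, a i ≤ (∑ i, a i * p i) / 2 ∨ x ≤ p i) :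
    ∑ W ∈ (Finset.univ : Finset (Finset ι)).filter (fun W => ∑ i ∈ W, a i ≤ j), (∏ k, if k ∈ W then p k else 1 - p k) ≤ 1 - x := by
  set m : ℝ := ∑ i, a i * p i with hm
  have hw0 : ∀ W : Finset ι, 0 ≤ (∏ k, if k ∈ W then p k else 1 - p k) := bernoulliWeight_nonneg hp0 hp1
  have hm0 : 0 < m := by linarith
  by_cases hbig : ∃ i, m / 2 < a i
  · -- a giant decides alone
    obtain ⟨i, hi⟩ := hbig
    have hxi : x ≤ p i := by
      rcases hgiant i with h | h
      · exact absurd h (not_le.2 hi)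
      · exact h
    calc ∑ W ∈ (Finset.univ : Finset (Finset ι)).filter (fun W => ∑ i ∈ W, a i ≤ j), (∏ k, if k ∈ W then p k else 1 - p k)
        ≤ ∑ W ∈ (Finset.univ : Finset (Finset ι)).filter (fun W => i ∉ W), (∏ k, if k ∈ W then p k else 1 - p k) := by
          refine Finset.sum_le_sum_of_subset_of_nonneg (fun W hW => ?_) fun W _ _ => hw0 W
          rw [Finset.mem_filter] at hW ⊢
          refine ⟨hW.1, fun hiW => ?_⟩
          have hle : a i ≤ ∑ k ∈ W, a k := Finset.single_le_sum (fun k _ => ha k) hiW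
          linarith [hW.2]
      _ = 1 - p i := sum_bernoulliWeight_filter_not_mem p i
      _ ≤ 1 - x := by linarith
  · -- no blob above half the mean: Cantelli
    push Not at hbig
    set V : ℝ := ∑ i, a i ^ 2 * p i * (1 - p i) with hV
    have hjm : j < m := by linarith
    have hC := count_cantelli p a hp0 hp1 j hjm
    have hV0 : 0 ≤ V := Finset.sum_nonneg fun i _ => by
      have := hp0 i; have := hp1 i; have := ha i
      have : 0 ≤ 1 - p i := by linarith
      positivity
    -- `V ≤ (m/2)·m`
    have hVle : V ≤ m / 2 * m := by
      have h1 : ∀ i, a i ^ 2 * p i * (1 - p i) ≤ m / 2 * (a i * p i) := by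
        intro i
        have hq : 0 ≤ 1 - p i := by linarith [hp1 i]
        have e : a i ^ 2 * p i * (1 - p i) = a i * (a i * p i * (1 - p i)) := by ring
        rw [e]
        have hapq : 0 ≤ a i * p i * (1 - p i) := mul_nonneg (mul_nonneg (ha i) (hp0 i)) hq
        calc a i * (a i * p i * (1 - p i)) ≤ m / 2 * (a i * p i * (1 - p i)) :=
              mul_le_mul_of_nonneg_right (hbig i) hapq
          _ ≤ m / 2 * (a i * p i) := by
              refine mul_le_mul_of_nonneg_left ?_ (by linarith)
              have := mul_nonneg (ha i) (hp0 i)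
              nlinarith [hp0 i]
      calc V = ∑ i, a i ^ 2 * p i * (1 - p i) := hV
        _ ≤ ∑ i, m / 2 * (a i * p i) := Finset.sum_le_sum fun i _ => h1 i
        _ = m / 2 * m := by rw [← Finset.mul_sum]
    -- `(m − j)² ≥ m²/4`
    have hmj : m / 2 ≤ m - j := by linarith
    have hsq : (m / 2) ^ 2 ≤ (m - j) ^ 2 := pow_le_pow_left₀ (by linarith) hmj 2
    have hD : 0 < V + (m - j) ^ 2 := by nlinarith
    -- `V/(V + (m−j)²) ≤ 2/3`
    have hfrac : V / (V + (m - j) ^ 2) ≤ 2 / 3 := by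
      rw [div_le_div_iff₀ hD (by norm_num : (0:ℝ) < 3)]
      nlinarith
    calc ∑ W ∈ (Finset.univ : Finset (Finset ι)).filter (fun W => ∑ i ∈ W, a i ≤ j), (∏ k, if k ∈ W then p k else 1 - p k)
        ≤ V / (V + (m - j) ^ 2) := hC
      _ ≤ 2 / 3 := hfrac
      _ ≤ 1 - x := by linarith

end IndepBlob

end Quant

end Summit.CriticalPhenomena.PercolationContinuityZ3.Theorems
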